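import Literature.NumberTheory.Sieve.GrimmeltMerikoski2025Poisson
import Literature.NumberTheory.Sieve.PolynomialCongruences
import Literature.NumberTheory.Sieve.BombieriFriedlanderIwaniecTheorem5Poisson
import Literature.NumberTheory.LFunctions.PoissonTwistedProgression
import HarnessLib

/-!
# Grimmelt–Merikoski 2025: the Poisson-dual (Weyl-sum) form of the smoothed root count

L. Grimmelt, J. Merikoski, *On the greatest prime factor and uniform equidistribution of quadratic
polynomials*, arXiv:2505.00493 [GrimmeltMerikoski2025].  The Type I form of Theorem 1.4
(`GM2025.typeISum`, `GrimmeltMerikoski2025.lean`) is built from the smoothed root count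
`GM2025.rootSum a h k ψ X = ∑_{aℓ²+h ≡ 0 (k)} ψ(ℓ/X)` and its discrepancy
`GM2025.rootDiscrepancy = rootSum − (ϱ_{a,h}(k)/k) X ∫ψ`.  §1.2 of the paper recalls the classical
treatment of such sums ("Hooley [hooley] estimated the Type I sums by using the Gauss
correspondence to connect them to Kloosterman sums"; Deshouillers–Iwaniec, Duke–Friedlander–Iwaniec,
Tóth), whose first step — and the "Poisson summation on `ℓ`" invoked in the first paragraph of §5 —
is the exact dual form PROVED here, written in the tree's Weyl-sum vocabulary
`Literature.NumberTheory.Sieve.polyRootWeylSum f k m = ∑_{ν mod k, f(ν) ≡ 0} e(mν/k)`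
(`PolynomialCongruences.lean`, the currency of the Duke–Friedlander–Iwaniec / Tóth files
`QuadraticRootsPrimeModuliToth*.lean`) for `f = aX² + h`:

* `GM2025.rootSum_eq_tsum_fourier_mul_weylSum` — for `k ≥ 1`, `X > 0` and an admissible `ψ`,
  `∑_{aℓ²+h ≡ 0 (k)} ψ(ℓ/X) = (X/k) ∑_{m ∈ ℤ} 𝓕ψ(mX/k) · S_{aX²+h}(k, m)`
  (Mathlib's `𝓕ψ(ξ) = ∫ ψ(u) e(−uξ) du`);
* `GM2025.rootDiscrepancy_eq_tsum` — the `m = 0` term is the main term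
  (`𝓕ψ(0) = ∫ψ`, `S(k, 0) = ϱ_{a,h}(k)`), so `disc_{a,h}(k; ψ, X) = (X/k) ∑_{m ≠ 0} 𝓕ψ(mX/k) S(k, m)`;
* `GM2025.norm_rootDiscrepancy_sub_sum_le` — truncation at `|m| ≤ M` by repeated partial
  integration: the tail is `≤ (X/k) ϱ_{a,h}(k) · 4B (k/(2πX))ⁿ M^{1−n}` for `2 ≤ n ≤ J`;
* `GM2025.typeISum_le_of_approx`, `GM2025.typeISum_le_dualForm_add` — consequently the Type I
  form `GM2025.typeISum a h ψ₁ ψ₂ X K D` is at most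
  `∑_{d ≤ D} |∑_{k ≡ 0 (d)} ψ₁(k/K) (X/k) ∑_{1 ≤ |m| ≤ M} 𝓕ψ₂(mX/k) S_{aX²+h}(k, m)|` plus the
  summed tail `∑_d ∑_k B₁ (X/k) ϱ_{a,h}(k) 4B (k/(2πX))ⁿ M^{1−n}` — the form in which bounds for
  the Weyl sums over `k ≡ 0 (mod d)` enter a Type I estimate.

Everything is PROVED from the tree's Poisson toolkit (`FriedlanderIwaniecPrimes.tsum_arithProg_eq_tsum_fourier`,
`….sum_tail_norm_fourier_div_le`, `MatomakiMerikoski.fourier_comp_div`,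
`BFI.tsum_int_eq_add_sum_add_tsum`) and `GM2025.rootSum_eq_sum_tsum`.  Nothing here touches the
deep input of the paper ([GMtechnical, Thm 2.1]); the named fact
`grimmeltMerikoski2025_thm14_restricted` is unchanged.

## References

* [GrimmeltMerikoski2025] arXiv:2505.00493, §1.2 (classical approach via the Gauss correspondence
  and Kloosterman sums) and §5, first paragraph ("Poisson summation on ℓ").
* C. Hooley, *On the greatest prime factor of a quadratic polynomial*, Acta Math. 117 (1967),
  281–299 — the origin of the reduction of these congruence sums to the exponential sums
  `∑_ν e(mν/k)` (as cited in [GrimmeltMerikoski2025, §1.2, ref. [hooley]]).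
-/

noncomputable section

namespace Literature.NumberTheory.Sieve

open Finset Polynomial MeasureTheory Real Complex
open scoped FourierTransform ContDiff

namespace GM2025

/-! ### The Weyl sums of `aX² + h` -/

/-- The root set of `aX² + h` modulo `k` used by `polyRootWeylSum` is the one used by
`GM2025.rootSum` / `GM2025.rho`. [folklore] -/
theorem filter_dvd_eval_quadratic (a h k : ℕ) :
    (range k).filter (fun ν : ℕ => (k : ℤ) ∣ (C (a : ℤ) * X ^ 2 + C (h : ℤ) : ℤ[X]).eval (ν : ℤ)) =
      (range k).filter (fun ν : ℕ => (k : ℤ) ∣ (a : ℤ) * (ν : ℤ) ^ 2 + (h : ℤ)) := by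
  refine filter_congr fun ν _ => ?_
  simp only [eval_add, eval_mul, eval_C, eval_pow, eval_X]

/-- `S_{aX²+h}(k, m) = ∑_{0 ≤ ν < k, k ∣ aν²+h} e(mν/k)`. [folklore] -/
theorem polyRootWeylSum_quadratic_eq (a h k : ℕ) (m : ℤ) :
    polyRootWeylSum (C (a : ℤ) * X ^ 2 + C (h : ℤ)) k m =
      ∑ ν ∈ (range k).filter (fun ν : ℕ => (k : ℤ) ∣ (a : ℤ) * (ν : ℤ) ^ 2 + (h : ℤ)),
        Complex.exp (2 * Real.pi * Complex.I * (m * ν / k : ℂ)) := by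
  rw [polyRootWeylSum, filter_dvd_eval_quadratic]

/-- `ϱ_{a,h}(k) = S_{aX²+h}(k, 0)`. [folklore] -/
theorem rho_eq_polyRootWeylSum_zero (a h k : ℕ) :
    (rho a h k : ℂ) = polyRootWeylSum (C (a : ℤ) * X ^ 2 + C (h : ℤ)) k 0 := by
  rw [polyRootWeylSum_zero_right]
  rfl

/-- `|S_{aX²+h}(k, m)| ≤ ϱ_{a,h}(k)`. [folklore] -/
theorem norm_polyRootWeylSum_quadratic_le (a h k : ℕ) (m : ℤ) :
    ‖polyRootWeylSum (C (a : ℤ) * X ^ 2 + C (h : ℤ)) k m‖ ≤ rho a h k :=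
  norm_polyRootWeylSum_le _ k m

/-- `𝓕ψ(0) = ∫ψ`. [folklore] -/
theorem fourier_zero_eq_integral (ψ : ℝ → ℂ) : 𝓕 ψ 0 = ∫ u, ψ u := by
  rw [Real.fourier_real_eq]
  congr 1
  funext v
  simp

/-! ### Sums over `ℤ ∖ {0}`: splitting at `|m| ≤ M` and the two-sided tail -/

/-- `∑_{m ≠ 0} f(m) = ∑_{1 ≤ m ≤ M} (f(m) + f(−m)) + ∑_{i ≥ 0} (f(i+M+1) + f(−(i+M+1)))` for a
summable `f : ℤ → ℂ`. [folklore] -/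
theorem tsum_ite_eq_sum_add_tsum {f : ℤ → ℂ} (hf : Summable f) (M : ℕ) :
    ∑' m : ℤ, (if m = 0 then 0 else f m) =
      ∑ m ∈ Icc 1 M, (f m + f (-(m : ℤ))) +
        ∑' i : ℕ, (f ((i + (M + 1) : ℕ) : ℤ) + f (-((i + (M + 1) : ℕ) : ℤ))) := by
  have hgS : Summable fun m : ℤ => if m = 0 then 0 else f m := by
    refine Summable.of_norm_bounded hf.norm fun m => ?_
    split_ifs
    · rw [norm_zero]; exact norm_nonneg _
    · exact le_rfl
  rw [BFI.tsum_int_eq_add_sum_add_tsum hgS M, if_pos rfl, zero_add]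
  refine congrArg₂ (· + ·) (sum_congr rfl fun m hm => ?_) (tsum_congr fun i => ?_)
  · rw [mem_Icc] at hm
    have h0 : ((m : ℕ) : ℤ) ≠ 0 := by omega
    have h0' : -((m : ℕ) : ℤ) ≠ 0 := by omega
    rw [if_neg h0, if_neg h0']
  · have h0 : ((i + (M + 1) : ℕ) : ℤ) ≠ 0 := by omega
    have h0' : -((i + (M + 1) : ℕ) : ℤ) ≠ 0 := by omega
    rw [if_neg h0, if_neg h0']

/-- The two-sided tail `i ↦ f(i+M+1) + f(−(i+M+1))` of a summable `f : ℤ → ℂ` is summable.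
[folklore] -/
theorem summable_twoSidedTail {f : ℤ → ℂ} (hf : Summable f) (M : ℕ) :
    Summable fun i : ℕ => f ((i + (M + 1) : ℕ) : ℤ) + f (-((i + (M + 1) : ℕ) : ℤ)) := by
  have h1 : Summable fun n : ℕ => f n := hf.comp_injective Nat.cast_injective
  have h2 : Summable fun n : ℕ => f (-(n : ℤ)) :=
    hf.comp_injective fun a b hab => by simpa using hab
  exact ((summable_nat_add_iff (f := fun n : ℕ => f n) (M + 1)).2 h1).add
    ((summable_nat_add_iff (f := fun n : ℕ => f (-(n : ℤ))) (M + 1)).2 h2)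

/-- **Tail bound**: if `|f(m)| ≤ φ(m)` and `∑_{M < m ≤ N} (φ(m) + φ(−m)) ≤ C` for every `N`, then
`|∑_{|m| > M} f(m)| ≤ C`. [folklore] -/
theorem norm_tsum_twoSidedTail_le {f : ℤ → ℂ} (hf : Summable f) {φ : ℤ → ℝ}
    (hφ : ∀ m, ‖f m‖ ≤ φ m) (M : ℕ) {C : ℝ}
    (hC : ∀ N : ℕ, ∑ m ∈ Ioc M N, (φ m + φ (-(m : ℤ))) ≤ C) :
    ‖∑' i : ℕ, (f ((i + (M + 1) : ℕ) : ℤ) + f (-((i + (M + 1) : ℕ) : ℤ)))‖ ≤ C := by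
  refine BFI.norm_tsum_nat_le_of_sum_range_le (summable_twoSidedTail hf M) fun N => ?_
  calc ∑ i ∈ range N, ‖f ((i + (M + 1) : ℕ) : ℤ) + f (-((i + (M + 1) : ℕ) : ℤ))‖
      ≤ ∑ i ∈ range N, (φ ((i + (M + 1) : ℕ) : ℤ) + φ (-((i + (M + 1) : ℕ) : ℤ))) :=
        sum_le_sum fun i _ => (norm_add_le _ _).trans (add_le_add (hφ _) (hφ _))
    _ = ∑ m ∈ Ioc M (M + N), (φ m + φ (-(m : ℤ))) := by
        rw [← Finset.Ico_add_one_add_one_eq_Ioc, Finset.sum_Ico_eq_sum_range,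
          show M + N + 1 - (M + 1) = N by omega]
        refine sum_congr rfl fun i _ => ?_
        rw [show M + 1 + i = i + (M + 1) by ring]
    _ ≤ C := hC (M + N)

/-! ### The dual form of the smoothed root count -/

/-- **Poisson-dual (Weyl-sum) form of the smoothed root count.** For `k ≥ 1`, `X > 0` and an
admissible weight `ψ` on `[-1, 1]`,
`∑_{ℓ ∈ ℤ, aℓ²+h ≡ 0 (k)} ψ(ℓ/X) = (X/k) ∑_{m ∈ ℤ} 𝓕ψ(mX/k) ∑_{ν mod k, aν²+h ≡ 0} e(mν/k)`:
split into root classes `ℓ ≡ ν (mod k)` (`rootSum_eq_sum_tsum`), apply Poisson summation along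
each class (`∑_t F(ν + kt) = k⁻¹ ∑_m e(νm/k) 𝓕F(m/k)` with `F = ψ(·/X)`, `𝓕F(ξ) = X 𝓕ψ(Xξ)`) and
interchange the finite sum over `ν` with the sum over `m`.  This is the first step of the
classical (Hooley / Duke–Friedlander–Iwaniec / Tóth) treatment recalled in
[GrimmeltMerikoski2025, §1.2], and the "Poisson summation on `ℓ`" of [GrimmeltMerikoski2025, §5].
[folklore] -/
theorem rootSum_eq_tsum_fourier_mul_weylSum {ψ : ℝ → ℂ} {J : ℕ} {B : ℝ}
    (hψ : IsAdmissibleWeight ψ (-1) 1 J B) (a h : ℕ) {k : ℕ} (hk : 0 < k) {X : ℝ} (hX : 0 < X) :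
    rootSum a h k ψ X =
      ((X / k : ℝ) : ℂ) * ∑' m : ℤ, 𝓕 ψ ((m : ℝ) * X / k) *
        polyRootWeylSum (C (a : ℤ) * Polynomial.X ^ 2 + C (h : ℤ)) k m := by
  have hkr : (0 : ℝ) < k := Nat.cast_pos.mpr hk
  set R := (range k).filter (fun ν : ℕ => (k : ℤ) ∣ (a : ℤ) * (ν : ℤ) ^ 2 + (h : ℤ)) with hR
  -- the dilated weight `F = ψ(·/X)`
  set F : ℝ → ℂ := fun u => ψ (u / X) with hF
  have hFd : ContDiff ℝ ∞ F := hψ.1.comp (contDiff_id.div_const X)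
  have hFc : HasCompactSupport F := by
    have : F = fun u => ψ (X⁻¹ • u) := by
      funext u
      simp only [hF, smul_eq_mul, div_eq_inv_mul]
    rw [this]
    exact hψ.hasCompactSupport.comp_smul (inv_ne_zero hX.ne')
  -- Poisson summation along each residue class `ν (mod k)`
  have hP : ∀ ν : ℕ, ∑' t : ℤ, ψ (((ν : ℝ) + (k : ℝ) * (t : ℝ)) / X) =
      (k : ℂ)⁻¹ * ∑' m : ℤ, (𝐞 ((ν : ℝ) * m / k) : ℂ) * 𝓕 F ((m : ℝ) / k) := by
    intro ν
    have h1 := FriedlanderIwaniecPrimes.tsum_arithProg_eq_tsum_fourier hFd hFc hk (ν : ℤ)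
    simp only [Int.cast_natCast] at h1
    exact h1
  have hS : ∀ ν : ℕ, Summable fun m : ℤ => (𝐞 ((ν : ℝ) * m / k) : ℂ) * 𝓕 F ((m : ℝ) / k) :=
    fun ν => LFunctions.MatomakiMerikoski.summable_fourierChar_mul_fourier_div hFd hFc hkr _
  -- the Fourier transform of the dilate
  have hFT : ∀ m : ℤ, 𝓕 F ((m : ℝ) / k) = (X : ℂ) * 𝓕 ψ ((m : ℝ) * X / k) := by
    intro m
    rw [hF, LFunctions.MatomakiMerikoski.fourier_comp_div ψ hX]
    congr 2
    ring
  have hswap : ∑ ν ∈ R, ∑' m : ℤ, (𝐞 ((ν : ℝ) * m / k) : ℂ) * 𝓕 F ((m : ℝ) / k) =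
      ∑' m : ℤ, ∑ ν ∈ R, (𝐞 ((ν : ℝ) * m / k) : ℂ) * 𝓕 F ((m : ℝ) / k) :=
    (Summable.tsum_finsetSum (s := R) fun ν _ => hS ν).symm
  have hconst : ((X / k : ℝ) : ℂ) = (k : ℂ)⁻¹ * (X : ℂ) := by
    push_cast
    ring
  rw [rootSum_eq_sum_tsum hψ a h hk hX, ← hR, sum_congr rfl fun ν _ => hP ν, ← mul_sum, hswap,
    hconst, mul_assoc]
  congr 1
  rw [← tsum_mul_left]
  refine tsum_congr fun m => ?_
  rw [polyRootWeylSum_quadratic_eq, ← hR, ← mul_assoc, mul_sum]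
  refine sum_congr rfl fun ν _ => ?_
  rw [hFT, Real.fourierChar_apply, mul_comm]
  congr 2
  push_cast
  ring

/-- The dual coefficients `m ↦ 𝓕ψ(mX/k) S_{aX²+h}(k, m)` are summable over `ℤ`
(`|𝓕ψ(mX/k)| ≪ m⁻²`, `|S| ≤ ϱ`). [folklore] -/
theorem summable_fourier_mul_weylSum {ψ : ℝ → ℂ} {J : ℕ} {B : ℝ}
    (hψ : IsAdmissibleWeight ψ (-1) 1 J B) (a h : ℕ) {k : ℕ} (hk : 0 < k) {X : ℝ} (hX : 0 < X) :
    Summable fun m : ℤ => 𝓕 ψ ((m : ℝ) * X / k) *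
      polyRootWeylSum (C (a : ℤ) * Polynomial.X ^ 2 + C (h : ℤ)) k m := by
  have hkr : (0 : ℝ) < k := Nat.cast_pos.mpr hk
  have h1 : Summable fun m : ℤ => 𝓕 ψ ((m : ℝ) / (k / X)) :=
    FriedlanderIwaniecPrimes.summable_fourier_div hψ.1 hψ.hasCompactSupport (div_pos hkr hX)
  refine Summable.of_norm_bounded (h1.norm.mul_right (rho a h k : ℝ)) fun m => ?_
  rw [norm_mul, show (m : ℝ) * X / k = m / (k / X) by field_simp]
  exact mul_le_mul_of_nonneg_left (norm_polyRootWeylSum_quadratic_le a h k m) (norm_nonneg _)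

/-- **The discrepancy in dual form**: for `k ≥ 1`, `X > 0` and an admissible `ψ` on `[-1, 1]`,
`∑_{aℓ²+h ≡ 0 (k)} ψ(ℓ/X) − (ϱ_{a,h}(k)/k) X ∫ψ = (X/k) ∑_{m ≠ 0} 𝓕ψ(mX/k) S_{aX²+h}(k, m)`
(the `m = 0` term of `rootSum_eq_tsum_fourier_mul_weylSum` is `𝓕ψ(0) S(k,0) = (∫ψ) ϱ_{a,h}(k)`,
the main term).  [folklore] -/
theorem rootDiscrepancy_eq_tsum {ψ : ℝ → ℂ} {J : ℕ} {B : ℝ}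
    (hψ : IsAdmissibleWeight ψ (-1) 1 J B) (a h : ℕ) {k : ℕ} (hk : 0 < k) {X : ℝ} (hX : 0 < X) :
    rootDiscrepancy a h k ψ X =
      ((X / k : ℝ) : ℂ) * ∑' m : ℤ, if m = 0 then 0 else
        𝓕 ψ ((m : ℝ) * X / k) * polyRootWeylSum (C (a : ℤ) * Polynomial.X ^ 2 + C (h : ℤ)) k m := by
  have hS := summable_fourier_mul_weylSum hψ a h hk hX
  unfold rootDiscrepancy
  rw [rootSum_eq_tsum_fourier_mul_weylSum hψ a h hk hX, hS.tsum_eq_add_tsum_ite 0]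
  simp only [Int.cast_zero, zero_mul, zero_div]
  rw [fourier_zero_eq_integral, ← rho_eq_polyRootWeylSum_zero]
  push_cast
  ring

/-- **Truncating the dual sum** (repeated partial integration): for `k ≥ 1`, `X > 0`, an admissible
`ψ` on `[-1, 1]` with derivative bound `B` up to order `J`, `2 ≤ n ≤ J` and `M ≥ 1`,
`|disc_{a,h}(k; ψ, X) − (X/k) ∑_{1 ≤ |m| ≤ M} 𝓕ψ(mX/k) S(k, m)| ≤ (X/k) ϱ_{a,h}(k) · 4B (k/(2πX))ⁿ M^{1−n}`
(`|𝓕ψ(mX/k)| ≤ ‖ψ⁽ⁿ⁾‖₁ (k/(2πX))ⁿ |m|⁻ⁿ`, `‖ψ⁽ⁿ⁾‖₁ ≤ 2B`, `∑_{|m| > M} |m|⁻ⁿ ≤ 2M^{1−n}`, `|S| ≤ ϱ`);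
in particular the dual sum is negligible beyond `|m| > X^{δ'} k/X`. [folklore] -/
theorem norm_rootDiscrepancy_sub_sum_le {ψ : ℝ → ℂ} {J : ℕ} {B : ℝ}
    (hψ : IsAdmissibleWeight ψ (-1) 1 J B) (a h : ℕ) {k : ℕ} (hk : 0 < k) {X : ℝ} (hX : 0 < X)
    {n : ℕ} (hn : 2 ≤ n) (hnJ : n ≤ J) {M : ℕ} (hM : 1 ≤ M) :
    ‖rootDiscrepancy a h k ψ X - ((X / k : ℝ) : ℂ) * ∑ m ∈ Icc 1 M,
        (𝓕 ψ ((m : ℝ) * X / k) * polyRootWeylSum (C (a : ℤ) * Polynomial.X ^ 2 + C (h : ℤ)) k m +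
          𝓕 ψ (-(m : ℝ) * X / k) *
            polyRootWeylSum (C (a : ℤ) * Polynomial.X ^ 2 + C (h : ℤ)) k (-(m : ℤ)))‖ ≤
      X / k * rho a h k * (4 * B * ((k / X) / (2 * π)) ^ n * ((M : ℝ) ^ (n - 1))⁻¹) := by
  have hkr : (0 : ℝ) < k := Nat.cast_pos.mpr hk
  have hd : (0 : ℝ) < k / X := div_pos hkr hX
  have hXk : (0 : ℝ) ≤ X / k := (div_pos hX hkr).le
  rw [rootDiscrepancy_eq_tsum hψ a h hk hX]
  set W : ℤ → ℂ := polyRootWeylSum (C (a : ℤ) * Polynomial.X ^ 2 + C (h : ℤ)) k with hW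
  have hfS : Summable fun m : ℤ => 𝓕 ψ ((m : ℝ) * X / k) * W m :=
    summable_fourier_mul_weylSum hψ a h hk hX
  have hfle : ∀ m : ℤ, ‖𝓕 ψ ((m : ℝ) * X / k) * W m‖ ≤ ‖𝓕 ψ ((m : ℝ) / (k / X))‖ * rho a h k := by
    intro m
    rw [norm_mul, show (m : ℝ) * X / k = m / (k / X) by field_simp]
    exact mul_le_mul_of_nonneg_left (norm_polyRootWeylSum_quadratic_le a h k m) (norm_nonneg _)
  -- the tail beyond `|m| > M`
  have hL1 : ∫ t, ‖iteratedDeriv n ψ t‖ ≤ 2 * B := hψ.integral_norm_iteratedDeriv_le hnJ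
  have hC : ∀ N : ℕ, ∑ m ∈ Ioc M N, (‖𝓕 ψ (((m : ℤ) : ℝ) / (k / X))‖ * rho a h k +
      ‖𝓕 ψ (((-(m : ℤ) : ℤ) : ℝ) / (k / X))‖ * rho a h k) ≤
      rho a h k * (4 * B * ((k / X) / (2 * π)) ^ n * ((M : ℝ) ^ (n - 1))⁻¹) := by
    intro N
    have h1 := FriedlanderIwaniecPrimes.sum_tail_norm_fourier_div_le hψ.1 hψ.hasCompactSupport
      hn hd hM N
    have h2 : ∑ m ∈ Ioc M N, (‖𝓕 ψ (((m : ℤ) : ℝ) / (k / X))‖ * rho a h k +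
        ‖𝓕 ψ (((-(m : ℤ) : ℤ) : ℝ) / (k / X))‖ * rho a h k) =
        rho a h k * ∑ m ∈ Ioc M N, (‖𝓕 ψ ((m : ℝ) / (k / X))‖ + ‖𝓕 ψ (-(m : ℝ) / (k / X))‖) := by
      rw [mul_sum]
      refine sum_congr rfl fun m _ => ?_
      push_cast
      ring
    rw [h2]
    refine mul_le_mul_of_nonneg_left (h1.trans ?_) (Nat.cast_nonneg _)
    have h0 : (0 : ℝ) ≤ ((k / X) / (2 * π)) ^ n * ((M : ℝ) ^ (n - 1))⁻¹ := by positivity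
    nlinarith
  have htail := norm_tsum_twoSidedTail_le hfS
    (φ := fun m : ℤ => ‖𝓕 ψ ((m : ℝ) / (k / X))‖ * rho a h k) hfle M hC
  -- assemble
  have hSS : ∑ m ∈ Icc 1 M, (𝓕 ψ (((m : ℤ) : ℝ) * X / k) * W m +
      𝓕 ψ (((-(m : ℤ) : ℤ) : ℝ) * X / k) * W (-(m : ℤ))) =
      ∑ m ∈ Icc 1 M, (𝓕 ψ ((m : ℝ) * X / k) * W m + 𝓕 ψ (-(m : ℝ) * X / k) * W (-(m : ℤ))) := by
    refine sum_congr rfl fun m _ => ?_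
    simp only [Int.cast_neg, Int.cast_natCast]
  rw [tsum_ite_eq_sum_add_tsum hfS M, mul_add, hSS, add_sub_cancel_left, norm_mul,
    Complex.norm_real, Real.norm_of_nonneg hXk]
  refine (mul_le_mul_of_nonneg_left htail hXk).trans_eq ?_
  ring

/-! ### The Type I form in dual form -/

/-- **Type I form against any approximation of the discrepancies**: if `|ψ₁| ≤ B₁` and
`|disc_{a,h}(k; ψ₂, X) − T(k)| ≤ E(k)` for every `k ≥ 1`, then
`∑_{d ≤ D} |∑_{k ≡ 0 (d)} ψ₁(k/K) disc(k)| ≤ ∑_{d ≤ D} |∑_{k ≡ 0 (d)} ψ₁(k/K) T(k)| + ∑_{d ≤ D} ∑_{k ≡ 0 (d)} B₁ E(k)`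
(`k` over `1 ≤ k ≤ 2K`). [folklore] -/
theorem typeISum_le_of_approx {ψ₁ : ℝ → ℂ} {B₁ : ℝ} (hB₁ : ∀ u, ‖ψ₁ u‖ ≤ B₁) (a h : ℕ)
    (ψ₂ : ℝ → ℂ) (X K D : ℝ) (T : ℕ → ℂ) (E : ℕ → ℝ)
    (hE : ∀ k : ℕ, 0 < k → ‖rootDiscrepancy a h k ψ₂ X - T k‖ ≤ E k) :
    typeISum a h ψ₁ ψ₂ X K D ≤
      ∑ d ∈ Icc 1 ⌊D⌋₊, ‖∑ k ∈ (Icc 1 ⌊2 * K⌋₊).filter (fun k : ℕ => d ∣ k),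
          ψ₁ ((k : ℝ) / K) * T k‖ +
        ∑ d ∈ Icc 1 ⌊D⌋₊, ∑ k ∈ (Icc 1 ⌊2 * K⌋₊).filter (fun k : ℕ => d ∣ k), B₁ * E k := by
  have hB0 : 0 ≤ B₁ := (norm_nonneg _).trans (hB₁ 0)
  unfold typeISum
  rw [← sum_add_distrib]
  refine sum_le_sum fun d _ => ?_
  have hsplit : ∑ k ∈ (Icc 1 ⌊2 * K⌋₊).filter (fun k : ℕ => d ∣ k),
      ψ₁ ((k : ℝ) / K) * rootDiscrepancy a h k ψ₂ X =
      ∑ k ∈ (Icc 1 ⌊2 * K⌋₊).filter (fun k : ℕ => d ∣ k), ψ₁ ((k : ℝ) / K) * T k +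
        ∑ k ∈ (Icc 1 ⌊2 * K⌋₊).filter (fun k : ℕ => d ∣ k),
          ψ₁ ((k : ℝ) / K) * (rootDiscrepancy a h k ψ₂ X - T k) := by
    rw [← sum_add_distrib]
    refine sum_congr rfl fun k _ => ?_
    ring
  rw [hsplit]
  refine (norm_add_le _ _).trans (add_le_add le_rfl ((norm_sum_le _ _).trans
    (sum_le_sum fun k hk => ?_)))
  rw [mem_filter, mem_Icc] at hk
  rw [norm_mul]
  exact mul_le_mul (hB₁ _) (hE k (by omega)) (norm_nonneg _) hB0

/-- **The Type I form of Theorem 1.4 in dual (Weyl-sum) form, up to a negligible tail**: for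
`|ψ₁| ≤ B₁`, an admissible `ψ₂` on `[-1, 1]` (derivative bound `B` up to order `J`), `X > 0`,
`2 ≤ n ≤ J` and `M ≥ 1`,
`∑_{d ≤ D} |∑_{k ≡ 0 (d)} ψ₁(k/K) disc_{a,h}(k; ψ₂, X)|`
`  ≤ ∑_{d ≤ D} |∑_{k ≡ 0 (d)} ψ₁(k/K) (X/k) ∑_{1 ≤ |m| ≤ M} 𝓕ψ₂(mX/k) S_{aX²+h}(k, m)|`
`    + ∑_{d ≤ D} ∑_{k ≡ 0 (d)} B₁ (X/k) ϱ_{a,h}(k) · 4B (k/(2πX))ⁿ M^{1−n}`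
— the form in which bounds for the Weyl sums `S_{aX²+h}(k, m) = ∑_{aν²+h ≡ 0 (k)} e(mν/k)` over
`k ≡ 0 (mod d)` (Hooley, Deshouillers–Iwaniec, Duke–Friedlander–Iwaniec, Tóth; recalled in
[GrimmeltMerikoski2025, §1.2]) enter the Type I estimate. [folklore] -/
theorem typeISum_le_dualForm_add {ψ₁ ψ₂ : ℝ → ℂ} {B₁ : ℝ} {J : ℕ} {B : ℝ}
    (hB₁ : ∀ u, ‖ψ₁ u‖ ≤ B₁) (hψ₂ : IsAdmissibleWeight ψ₂ (-1) 1 J B) (a h : ℕ) {X : ℝ}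
    (hX : 0 < X) (K D : ℝ) {n : ℕ} (hn : 2 ≤ n) (hnJ : n ≤ J) {M : ℕ} (hM : 1 ≤ M) :
    typeISum a h ψ₁ ψ₂ X K D ≤
      ∑ d ∈ Icc 1 ⌊D⌋₊, ‖∑ k ∈ (Icc 1 ⌊2 * K⌋₊).filter (fun k : ℕ => d ∣ k),
          ψ₁ ((k : ℝ) / K) * (((X / k : ℝ) : ℂ) * ∑ m ∈ Icc 1 M,
            (𝓕 ψ₂ ((m : ℝ) * X / k) *
                polyRootWeylSum (C (a : ℤ) * Polynomial.X ^ 2 + C (h : ℤ)) k m +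
              𝓕 ψ₂ (-(m : ℝ) * X / k) *
                polyRootWeylSum (C (a : ℤ) * Polynomial.X ^ 2 + C (h : ℤ)) k (-(m : ℤ))))‖ +
        ∑ d ∈ Icc 1 ⌊D⌋₊, ∑ k ∈ (Icc 1 ⌊2 * K⌋₊).filter (fun k : ℕ => d ∣ k),
          B₁ * (X / k * rho a h k * (4 * B * ((k / X) / (2 * π)) ^ n * ((M : ℝ) ^ (n - 1))⁻¹)) :=
  typeISum_le_of_approx hB₁ a h ψ₂ X K D
    (fun k : ℕ => ((X / k : ℝ) : ℂ) * ∑ m ∈ Icc 1 M,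
      (𝓕 ψ₂ ((m : ℝ) * X / k) * polyRootWeylSum (C (a : ℤ) * Polynomial.X ^ 2 + C (h : ℤ)) k m +
        𝓕 ψ₂ (-(m : ℝ) * X / k) *
          polyRootWeylSum (C (a : ℤ) * Polynomial.X ^ 2 + C (h : ℤ)) k (-(m : ℤ))))
    (fun k : ℕ => X / k * rho a h k * (4 * B * ((k / X) / (2 * π)) ^ n * ((M : ℝ) ^ (n - 1))⁻¹))
    fun _ hk => norm_rootDiscrepancy_sub_sum_le hψ₂ a h hk hX hn hnJ hM

end GM2025

end Literature.NumberTheory.Sieve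

end
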